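import Summits.ResolutionOfSingularities.ResolutionOfSingularities.Theorems.TeissierJungTeissierResolveRegularBranches
import HarnessLib

/-!
# `TeissierResolve` — support lemmas III: completed local rings above = normalised branches below

Support lemmas (pure algebra) for the crux `stmt-ResolutionOfSingularities-17086`
(`Summit.ResolutionOfSingularities.ResolutionOfSingularities.Theses.TeissierJung.TeissierResolve`),
line `Sketch` (toric normalisation + destackification), stub `stub_branchDictionary` (the
"branch dictionary", proved in `TeissierJungTeissierResolveBranchDictionary.lean`): the
completed local rings of the normalisation of a variety are the normalisations of its analytic
branches (Zariski's analytic normality; Nagata (37.5)–(37.8); Stacks 0C23 + 07N9). This file is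
the local algebra, built on the bricks of `TeissierJungTeissierResolveBranchAlgebra.lean`
(`Stacks07N9_local`, `ψ_𝔫 : R̂ → (C_𝔫)^`, `ker_psi_mem_minimalPrimes`, `psiPi_birational`,
`psi_isIntegralElem`).

* `exists_equiv_integralClosure_branch` — LOCAL: `R` a Noetherian local domain, `C ⊇ R` a
  domain, module-finite and birational, all `(C_𝔪)^` domains, `(C_𝔫)^` integrally closed.
  Then there are a minimal prime `P` of `R̂` (namely `P = ker ψ_𝔫`) and a ring isomorphism
  `(C_𝔫)^ ≃ integralClosure (R̂ ⧸ P) (Frac (R̂ ⧸ P))` turning `ψ_𝔫` into the structure map: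
  `R̂ ⧸ P ↪ (C_𝔫)^` is injective, integral and birational into an integrally closed domain, so
  `Frac (C_𝔫)^ = Frac (R̂ ⧸ P)` and `(C_𝔫)^` is the integral closure (`IsIntegralClosure`).
* `exists_branchEquiv_of_isLocalization` — GLOBAL: `A` a Noetherian domain, `C₀ ⊇ A` a domain,
  module-finite and birational, analytically irreducible at maximal ideals, `Q` maximal over the
  maximal `𝔭` with `((C₀)_Q)^` normal; for any localisation `R` of `A` at `𝔭`, any local ring
  `T ≅ (C₀)_Q` and any compatible `φ : R → T`: a minimal prime `P ⊆ R̂` and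
  `T̂ ≃ integralClosure (R̂ ⧸ P) (Frac (R̂ ⧸ P))` compatible with `φ` (localise `C₀` at `A ∖ 𝔭`
  and apply the local theorem at `𝔫 = Q C`).

Sources: O. Zariski, *Sur la normalité analytique des variétés normales*, Ann. Inst. Fourier 2
(1950); Zariski–Samuel, *Commutative Algebra* II, VIII §13; M. Nagata, *Local Rings* (1962),
(37.5)–(37.8); Huneke–Swanson, *Integral Closure of Ideals, Rings, and Modules*, Ch. 9;
Stacks 07N9, 0C23. Everything here is [folklore]; no definitions, no named facts.
-/

noncomputable section

set_option linter.dupNamespace false -- mandated namespace of this single-conjunct summit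

open IsLocalRing
open Literature.AlgebraicGeometry.Resolution
open Summit.ResolutionOfSingularities.ResolutionOfSingularities.Theorems.TeissierResolve.RegularBranches

namespace Summit.ResolutionOfSingularities.ResolutionOfSingularities.Theorems.TeissierResolve.BranchDictionaryLemmas

universe u

/-! ## Local algebra: `(C_𝔫)^` is the normalisation of the branch `R̂ ⧸ ker ψ_𝔫` -/

section Core

variable {R : Type u} [CommRing R] [IsNoetherianRing R] [IsLocalRing R]
variable {C : Type u} [CommRing C] [Algebra R C] [Module.Finite R C]

/-- **The completed local ring above is the normalisation of an analytic branch below.** Let `R`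
be a Noetherian local domain and `C ⊇ R` a domain, module-finite and birational over `R`, all of
whose completed local rings `(C_𝔪)^` at maximal ideals are domains, and let `𝔫` be a maximal
ideal of `C` with `(C_𝔫)^` integrally closed. Write `ψ_𝔫 : R̂ → R̂ ⊗_R C ≅ Π_𝔪 (C_𝔪)^ → (C_𝔫)^`
(`Stacks07N9_local`). Then `(C_𝔫)^` is the integral closure of an analytic branch `R̂ ⧸ P` of
`R` in its fraction field: for a minimal prime `P` of `R̂` (namely `P = ker ψ_𝔫`,
`ker_psi_mem_minimalPrimes`) there is a ring isomorphism
`(C_𝔫)^ ≃ integralClosure (R̂ ⧸ P) (Frac (R̂ ⧸ P))` under which `ψ_𝔫` becomes the structure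
map — because `R̂ ⧸ P ↪ (C_𝔫)^` is injective, integral (`psi_isIntegralElem`) and birational
(`psiPi_birational`) into an integrally closed domain, whose fraction field is therefore
`Frac (R̂ ⧸ P)`. [folklore] -/
theorem exists_equiv_integralClosure_branch [IsDomain R] [IsDomain C]
    (hinj : Function.Injective (algebraMap R C))
    (hbir : ∀ c : C, ∃ s : R, s ≠ 0 ∧ ∃ a : R, s • c = algebraMap R C a)
    (hdom : ∀ m : MaximalSpectrum C, IsDomain
      (AdicCompletion (maximalIdeal (Localization.AtPrime m.asIdeal))
        (Localization.AtPrime m.asIdeal)))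
    (n : MaximalSpectrum C)
    [IsIntegrallyClosed (AdicCompletion (maximalIdeal (Localization.AtPrime n.asIdeal))
      (Localization.AtPrime n.asIdeal))] :
    ∃ (P : Ideal (AdicCompletion (maximalIdeal R) R))
      (_ : P ∈ minimalPrimes (AdicCompletion (maximalIdeal R) R))
      (E : AdicCompletion (maximalIdeal (Localization.AtPrime n.asIdeal))
          (Localization.AtPrime n.asIdeal) ≃+*
        integralClosure (AdicCompletion (maximalIdeal R) R ⧸ P)
          (FractionRing (AdicCompletion (maximalIdeal R) R ⧸ P))),
      ∀ r : AdicCompletion (maximalIdeal R) R,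
        E (Stacks07N9_local R C (Algebra.TensorProduct.includeRight r) n) =
          algebraMap _ _ (Ideal.Quotient.mk P r) := by
  classical
  haveI := n.isMaximal
  haveI := hdom n
  -- `Rh = R̂`, `D = (C_𝔫)^`, `ψ = ψ_𝔫 : R̂ → (C_𝔫)^` (the `ψ[n]` of `…BranchAlgebra.lean`)
  set Rh := AdicCompletion (maximalIdeal R) R
  set D := AdicCompletion (maximalIdeal (Localization.AtPrime n.asIdeal))
    (Localization.AtPrime n.asIdeal)
  set ψ : Rh →+* D := RingHom.comp (Pi.evalRingHom _ n)
    (RingHom.comp (RingEquiv.toRingHom (AlgEquiv.toRingEquiv (Stacks07N9_local R C)))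
      (AlgHom.toRingHom (Algebra.TensorProduct.includeRight (R := R) (A := C)
        (B := AdicCompletion (maximalIdeal R) R)))) with hψ
  set P : Ideal Rh := RingHom.ker ψ with hPdef
  have hPmin : P ∈ minimalPrimes Rh := ker_psi_mem_minimalPrimes hinj hbir hdom n
  haveI hPp : P.IsPrime := hPmin.1.1
  -- `ψb : R̂ ⧸ P ↪ D`
  obtain ⟨ψb, hψb_inj, hψb_mk⟩ : ∃ ψb : Rh ⧸ P →+* D, Function.Injective ψb ∧
      ∀ r, ψb (Ideal.Quotient.mk P r) = ψ r :=
    ⟨RingHom.kerLift _, RingHom.kerLift_injective _, fun r => RingHom.kerLift_mk _ r⟩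
  have hcomp : ψb.comp (Ideal.Quotient.mk P) = ψ := RingHom.ext hψb_mk
  letI : Algebra (Rh ⧸ P) D := ψb.toAlgebra
  -- `D` is integral over `R̂ ⧸ P`
  haveI : Algebra.IsIntegral (Rh ⧸ P) D := ⟨fun d => by
    obtain ⟨p, hp, hpd⟩ := psi_isIntegralElem (R := R) n d
    refine ⟨p.map (Ideal.Quotient.mk P), hp.map _, ?_⟩
    rw [Polynomial.eval₂_map, RingHom.algebraMap_toAlgebra, hcomp]
    exact hpd⟩
  -- denominators from `R ∖ 0` stay non-zero in `D`
  have hden : ∀ {s : R}, s ≠ 0 → ψb (Ideal.Quotient.mk P (algebraMap R Rh s)) ≠ 0 := by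
    intro s hs h
    rw [hψb_mk] at h
    exact of_algebraMap_ne_zero hinj hs n ((psiPi_of (R := R) (C := C) s n).symm.trans h)
  -- birationality of `ψb`
  have hbirb : ∀ d : D, ∃ σ ρ : Rh ⧸ P, ψb σ ≠ 0 ∧ ψb σ * d = ψb ρ := by
    intro d
    obtain ⟨b, rfl⟩ : ∃ b : ∀ m : MaximalSpectrum C,
        AdicCompletion (maximalIdeal (Localization.AtPrime m.asIdeal))
          (Localization.AtPrime m.asIdeal), b n = d := ⟨Pi.single n d, by simp⟩
    obtain ⟨s, hs, r, hr⟩ := psiPi_birational hbir b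
    refine ⟨Ideal.Quotient.mk P (algebraMap R Rh s), Ideal.Quotient.mk P r, hden hs, ?_⟩
    have h := congrFun hr n
    rw [Pi.mul_apply] at h
    rw [hψb_mk, hψb_mk]
    exact h
  -- the fraction field `L` of `D` is a fraction field of `R̂ ⧸ P`
  let L := FractionRing D
  haveI : IsScalarTower (Rh ⧸ P) D L := IsScalarTower.of_algebraMap_eq fun _ => rfl
  have halgL : ∀ x : Rh ⧸ P, algebraMap (Rh ⧸ P) L x = algebraMap D L (ψb x) := fun x =>
    IsScalarTower.algebraMap_apply (Rh ⧸ P) D L x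
  have hinjL : Function.Injective (algebraMap (Rh ⧸ P) L) := by
    rw [IsScalarTower.algebraMap_eq (Rh ⧸ P) D L]
    exact (IsFractionRing.injective D L).comp hψb_inj
  haveI : IsFractionRing (Rh ⧸ P) L := by
    refine ⟨fun y => ?_, fun z => ?_, fun {x y} h => ⟨1, by simpa using hinjL h⟩⟩
    · rw [halgL]
      exact IsLocalization.map_units L ⟨ψb y, mem_nonZeroDivisors_of_ne_zero
        ((map_ne_zero_iff ψb hψb_inj).mpr (nonZeroDivisors.ne_zero y.2))⟩
    · obtain ⟨⟨a, t⟩, hat⟩ := IsLocalization.surj (nonZeroDivisors D) z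
      obtain ⟨σ₁, ρ₁, hσ₁, h₁⟩ := hbirb a
      obtain ⟨σ₂, ρ₂, hσ₂, h₂⟩ := hbirb t
      have ht0 : (t : D) ≠ 0 := nonZeroDivisors.ne_zero t.2
      have key : ψb (σ₁ * ρ₂) = ψb σ₁ * ψb σ₂ * t := by rw [map_mul, ← h₂, mul_assoc]
      have key₂ : ψb (ρ₁ * σ₂) = ψb σ₁ * a * ψb σ₂ := by rw [map_mul, ← h₁]
      have hneD : ψb (σ₁ * ρ₂) ≠ 0 := by
        rw [key]; exact mul_ne_zero (mul_ne_zero hσ₁ hσ₂) ht0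
      refine ⟨⟨ρ₁ * σ₂, ⟨σ₁ * ρ₂,
        mem_nonZeroDivisors_of_ne_zero ((map_ne_zero_iff ψb hψb_inj).mp hneD)⟩⟩, ?_⟩
      show z * algebraMap (Rh ⧸ P) L (σ₁ * ρ₂) = algebraMap (Rh ⧸ P) L (ρ₁ * σ₂)
      have eL : z * algebraMap D L (ψb (σ₁ * ρ₂)) =
          (z * algebraMap D L t) * algebraMap D L (ψb σ₁ * ψb σ₂) := by
        rw [key, map_mul (algebraMap D L)]; ring
      rw [halgL, halgL, eL, hat, ← map_mul, key₂]
      congr 1; ring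
  -- `D` is the integral closure of `R̂ ⧸ P` in `L ≅ Frac (R̂ ⧸ P)`
  haveI : IsIntegralClosure D (Rh ⧸ P) L := IsIntegralClosure.of_isIntegrallyClosed D (Rh ⧸ P) L
  let eKL : FractionRing (Rh ⧸ P) ≃ₐ[Rh ⧸ P] L := FractionRing.algEquiv (Rh ⧸ P) L
  let e₁ : D ≃ₐ[Rh ⧸ P] integralClosure (Rh ⧸ P) L :=
    IsIntegralClosure.equiv (Rh ⧸ P) D L (integralClosure (Rh ⧸ P) L)
  let e₂ : integralClosure (Rh ⧸ P) (FractionRing (Rh ⧸ P)) ≃ₐ[Rh ⧸ P]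
      integralClosure (Rh ⧸ P) L :=
    ((integralClosure (Rh ⧸ P) (FractionRing (Rh ⧸ P))).equivMapOfInjective eKL.toAlgHom
      eKL.injective).trans (Subalgebra.equivOfEq _ _ (integralClosure_map_algEquiv eKL))
  refine ⟨P, hPmin, (e₁.trans e₂.symm).toRingEquiv, fun r => ?_⟩
  change (e₁.trans e₂.symm).toRingEquiv (ψ r) = _
  rw [← hψb_mk]
  exact (e₁.trans e₂.symm).commutes (Ideal.Quotient.mk P r)

end Core

/-! ## Global form: a finite birational extension `C₀ ⊇ A`, localised at maximal ideals -/

section Global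

variable {A : Type u} [CommRing A] [IsDomain A] [IsNoetherianRing A]
variable {C₀ : Type u} [CommRing C₀] [IsDomain C₀] [Algebra A C₀] [Module.Finite A C₀]

/-- **The branch dictionary, global algebraic form.** Let `A` be a Noetherian domain and
`C₀ ⊇ A` a domain, module-finite and birational over `A`, whose local rings at maximal ideals
have domains as completions; let `Q ⊆ C₀` be a maximal ideal over the maximal ideal `𝔭 ⊆ A`
with `((C₀)_Q)^` integrally closed. Let `R` be any localisation of `A` at `𝔭`, `T` any local
ring identified with `(C₀)_Q` by `eT`, and `φ : R → T` a ring map compatible with `A → C₀`.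
Then there are a minimal prime `P` of `R̂` and a ring isomorphism
`T̂ ≃ integralClosure (R̂ ⧸ P) (Frac (R̂ ⧸ P))` compatible with `φ` on `R`. (Localise:
`R ⊆ C = S⁻¹C₀` is finite birational with `C_𝔫 ≅ (C₀)_Q ≅ T` for the maximal `𝔫 = QC`, and
apply `exists_equiv_integralClosure_branch`.) [folklore] -/
theorem exists_branchEquiv_of_isLocalization
    (hinj : Function.Injective (algebraMap A C₀))
    (hbir : ∀ c : C₀, ∃ s : A, s ≠ 0 ∧ ∃ a : A, s • c = algebraMap A C₀ a)
    (hdom : ∀ (Q : Ideal C₀) [Q.IsMaximal],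
      IsDomain (AdicCompletion (maximalIdeal (Localization.AtPrime Q)) (Localization.AtPrime Q)))
    (𝔭 : Ideal A) [𝔭.IsMaximal] (Q : Ideal C₀) [Q.IsMaximal]
    (hQ : Q.comap (algebraMap A C₀) = 𝔭)
    [IsIntegrallyClosed
      (AdicCompletion (maximalIdeal (Localization.AtPrime Q)) (Localization.AtPrime Q))]
    (R : Type u) [CommRing R] [IsLocalRing R] [Algebra A R] [IsLocalization.AtPrime R 𝔭]
    (T : Type u) [CommRing T] [IsLocalRing T] (eT : T ≃+* Localization.AtPrime Q)
    (φ : R →+* T)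
    (hφ : ∀ a : A, eT (φ (algebraMap A R a)) =
      algebraMap C₀ (Localization.AtPrime Q) (algebraMap A C₀ a)) :
    ∃ (P : Ideal (AdicCompletion (maximalIdeal R) R))
      (_ : P ∈ minimalPrimes (AdicCompletion (maximalIdeal R) R))
      (E : AdicCompletion (maximalIdeal T) T ≃+*
        integralClosure (AdicCompletion (maximalIdeal R) R ⧸ P)
          (FractionRing (AdicCompletion (maximalIdeal R) R ⧸ P))),
      ∀ a : R, E (algebraMap T _ (φ a)) =
        algebraMap _ _ (Ideal.Quotient.mk P (algebraMap R _ a)) := by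
  classical
  -- the localisation `C = S⁻¹ C₀`, `S` the image of `A ∖ 𝔭`: a finite birational `R`-algebra
  set S := Algebra.algebraMapSubmonoid C₀ 𝔭.primeCompl with hSdef
  set C := Localization S with hC
  haveI : FaithfulSMul A C₀ := (faithfulSMul_iff_algebraMap_injective A C₀).mpr hinj
  have hS : S ≤ nonZeroDivisors C₀ :=
    algebraMapSubmonoid_le_nonZeroDivisors_of_faithfulSMul C₀ 𝔭.primeCompl_le_nonZeroDivisors
  haveI : IsDomain C := IsLocalization.isDomain_localization hS
  letI : Algebra R C := localizationAlgebra 𝔭.primeCompl C₀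
  haveI : IsScalarTower A R C := isScalarTower_localizationAlgebra 𝔭.primeCompl C₀
  haveI : IsNoetherianRing R := IsLocalization.isNoetherianRing 𝔭.primeCompl R inferInstance
  haveI : IsDomain R :=
    IsLocalization.isDomain_of_le_nonZeroDivisors (M := 𝔭.primeCompl) R
      𝔭.primeCompl_le_nonZeroDivisors
  haveI : IsLocalization (𝔭.primeCompl.map (algebraMap A C₀)) C := Localization.isLocalization
  haveI : Module.Finite R C := Module.Finite.of_isLocalization A C₀ 𝔭.primeCompl
  have hmap : algebraMap R C =
      IsLocalization.map (T := S) C (algebraMap A C₀) (Submonoid.le_comap_map _) := by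
    apply IsLocalization.ringHom_ext 𝔭.primeCompl
    simp only [IsLocalization.map_comp, ← IsScalarTower.algebraMap_eq]
  have hinjR : Function.Injective (algebraMap R C) := by
    rw [hmap]
    exact IsLocalization.map_injective_of_injective (M := 𝔭.primeCompl) (S := R) (Q := C) hinj
  have hinjAR : Function.Injective (algebraMap A R) :=
    IsLocalization.injective R 𝔭.primeCompl_le_nonZeroDivisors
  -- birationality of `C` over `R`
  have hbirC : ∀ c : C, ∃ s : R, s ≠ 0 ∧ ∃ a : R, s • c = algebraMap R C a := by
    intro c
    obtain ⟨c₀, t', rfl⟩ := IsLocalization.exists_mk'_eq S c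
    obtain ⟨t, ht, htt'⟩ := (Submonoid.mem_map).mp t'.2
    obtain ⟨u, hu, a, hua⟩ := hbir c₀
    refine ⟨algebraMap A R u, fun h0 => hu (hinjAR (by rw [h0, map_zero])),
      IsLocalization.mk' R a ⟨t, ht⟩, ?_⟩
    rw [Algebra.smul_def, ← IsScalarTower.algebraMap_apply, IsScalarTower.algebraMap_apply A C₀ C,
      IsLocalization.mul_mk'_eq_mk'_of_mul, ← Algebra.smul_def, hua, hmap, IsLocalization.map_mk']
    congr 1
    exact Subtype.ext htt'.symm
  -- analytic irreducibility at the maximal ideals of `C`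
  have hdomC : ∀ n : MaximalSpectrum C, IsDomain
      (AdicCompletion (maximalIdeal (Localization.AtPrime n.asIdeal))
        (Localization.AtPrime n.asIdeal)) := by
    intro n
    haveI := n.isMaximal
    set Q' := n.asIdeal.comap (algebraMap C₀ C) with hQ'
    have hQ'A : Q'.comap (algebraMap A C₀) = 𝔭 := by
      have e1 : Q'.comap (algebraMap A C₀) =
          (n.asIdeal.comap (algebraMap R C)).comap (algebraMap A R) := by
        rw [hQ', Ideal.comap_comap, Ideal.comap_comap, ← IsScalarTower.algebraMap_eq,
          ← IsScalarTower.algebraMap_eq]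
      rw [e1, under_eq_maximalIdeal_of_isMaximal R C n.asIdeal]
      exact IsLocalization.AtPrime.under_maximalIdeal R 𝔭
    haveI : Q'.IsMaximal :=
      Ideal.isMaximal_of_isIntegral_of_isMaximal_comap (R := A) Q' (by rw [hQ'A]; infer_instance)
    haveI := hdom Q'
    haveI : IsLocalization.AtPrime (Localization.AtPrime n.asIdeal) Q' :=
      IsLocalization.isLocalization_atPrime_localization_atPrime S n.asIdeal
    exact isDomain_adicCompletion_of_ringEquiv
      (IsLocalization.algEquiv Q'.primeCompl (Localization.AtPrime n.asIdeal)
        (Localization.AtPrime Q')).toRingEquiv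
  -- the maximal ideal `𝔫 = Q C` of `C` over `Q`, with `C_𝔫 ≅ (C₀)_Q`
  have hdisj : Disjoint (S : Set C₀) Q := by
    rw [Set.disjoint_left]
    rintro _ ⟨t, ht, rfl⟩ htQ
    exact ht (hQ ▸ Ideal.mem_comap.mpr htQ : t ∈ 𝔭)
  set 𝔫 := Q.map (algebraMap C₀ C) with h𝔫
  haveI h𝔫p : 𝔫.IsPrime := IsLocalization.isPrime_of_isPrime_disjoint S C Q inferInstance hdisj
  have h𝔫Q : 𝔫.comap (algebraMap C₀ C) = Q :=
    IsLocalization.under_map_of_isPrime_disjoint S C inferInstance hdisj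
  have h𝔫max : 𝔫.IsMaximal := by
    refine isMaximal_of_isPrime_of_map_maximalIdeal_le R C 𝔫 ?_
    have e1 : (maximalIdeal R).map (algebraMap R C) = 𝔭.map (algebraMap A C) := by
      rw [← IsLocalization.AtPrime.map_eq_maximalIdeal 𝔭 R, Ideal.map_map,
        ← IsScalarTower.algebraMap_eq]
    rw [e1, IsScalarTower.algebraMap_eq A C₀ C, ← Ideal.map_map, h𝔫]
    exact Ideal.map_mono (Ideal.map_le_iff_le_comap.mpr hQ.ge)
  haveI : IsLocalization.AtPrime (Localization.AtPrime 𝔫) Q := by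
    have h1 : IsLocalization.AtPrime (Localization.AtPrime 𝔫) (𝔫.comap (algebraMap C₀ C)) :=
      IsLocalization.isLocalization_atPrime_localization_atPrime S 𝔫
    refine @IsLocalization.of_le C₀ _ (𝔫.comap (algebraMap C₀ C)).primeCompl _ _ _ h1
      Q.primeCompl (fun x hx => ?_) (fun r hr => ?_)
    · change x ∉ Q
      rw [← h𝔫Q]
      exact hx
    · exact @IsLocalization.map_units C₀ _ (𝔫.comap (algebraMap C₀ C)).primeCompl _ _ _ h1
        ⟨r, show r ∉ _ by rw [h𝔫Q]; exact hr⟩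
  let n : MaximalSpectrum C := ⟨𝔫, h𝔫max⟩
  let e𝔫 : Localization.AtPrime Q ≃ₐ[C₀] Localization.AtPrime n.asIdeal :=
    IsLocalization.algEquiv Q.primeCompl (Localization.AtPrime Q) (Localization.AtPrime 𝔫)
  -- `(C_𝔫)^ ≅ ((C₀)_Q)^` is integrally closed
  haveI : IsIntegrallyClosed (AdicCompletion (maximalIdeal (Localization.AtPrime n.asIdeal))
      (Localization.AtPrime n.asIdeal)) :=
    IsIntegrallyClosed.of_equiv (adicCompletionCongr (maximalIdeal (Localization.AtPrime Q))
      (maximalIdeal (Localization.AtPrime n.asIdeal)) e𝔫.toRingEquiv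
      (by rw [RingEquiv.toRingHom_eq_coe]; exact IsLocalRing.map_ringEquiv_maximalIdeal _))
  -- the local theorem at `𝔫`
  obtain ⟨P, hP, E₀, hE₀⟩ :=
    exists_equiv_integralClosure_branch (R := R) (C := C) hinjR hbirC hdomC n
  -- `T ≅ (C₀)_Q ≅ C_𝔫`, compatibly with `R → C`, then complete
  let eT' : T ≃+* Localization.AtPrime n.asIdeal := eT.trans e𝔫.toRingEquiv
  have hcompat : ∀ a : R,
      eT' (φ a) = algebraMap C (Localization.AtPrime n.asIdeal) (algebraMap R C a) := by
    have key : eT'.toRingHom.comp φ =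
        (algebraMap C (Localization.AtPrime n.asIdeal)).comp (algebraMap R C) := by
      refine IsLocalization.ringHom_ext 𝔭.primeCompl (S := R) (RingHom.ext fun a => ?_)
      simp only [RingHom.comp_apply]
      rw [← IsScalarTower.algebraMap_apply A R C, IsScalarTower.algebraMap_apply A C₀ C,
        ← IsScalarTower.algebraMap_apply C₀ C]
      show e𝔫 (eT (φ (algebraMap A R a))) = _
      rw [hφ, AlgEquiv.commutes]
    intro a
    exact RingHom.congr_fun key a
  let êT := adicCompletionCongr (maximalIdeal T) (maximalIdeal (Localization.AtPrime n.asIdeal))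
    eT' (by rw [RingEquiv.toRingHom_eq_coe]; exact IsLocalRing.map_ringEquiv_maximalIdeal _)
  refine ⟨P, hP, êT.trans E₀, fun a => ?_⟩
  have hof : Stacks07N9_local R C (Algebra.TensorProduct.includeRight
      (algebraMap R (AdicCompletion (maximalIdeal R) R) a)) n =
        AdicCompletion.of _ _ (algebraMap C (Localization.AtPrime n.asIdeal) (algebraMap R C a)) :=
    psiPi_of (R := R) (C := C) a n
  rw [RingEquiv.trans_apply, AdicCompletion.algebraMap_apply, Algebra.algebraMap_self,
    RingHom.id_apply, adicCompletionCongr_of, hcompat, ← hof]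
  exact hE₀ _

end Global

end Summit.ResolutionOfSingularities.ResolutionOfSingularities.Theorems.TeissierResolve.BranchDictionaryLemmas

end
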